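import Mathlib
import HarnessLib
import Summits.HubbardSuperconductivity.HubbardSuperconductivity.Theorems.KLProgrammeKLRegimeSplitTwoLegCoreTSuccSep

/-!
# Route `KLProgramme` — ENGINE child 19918, two-leg slot: the `TwoLegCoreT` closers keyed on MOMENTUM-SIDE sizes (the most generic layer — any
# position representation of the engine's output feeds them: dual lattice `…TwoLegMomentsOffDiag`, time GRID `…TwoLegMomentsFromGrid`)

Cell `gate-hubbard-kl`, seat p1b (g7).  `twoLegCoreT_zero_of_exports_sep` / `twoLegCoreT_succ_of_exports_sep` (p499964 / p501081) read position
moments of the DUAL-LATTICE kernels `sectorisedKernel β (trivialMultiplier) …`; the scale-0 engine runs on the `4M` time grid, whose natural (M1) bridge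
is `…TwoLegMomentsFromGrid` (no analysis map).  So the closers are restated one level up, on the sizes every bridge produces:

* **`twoLegCoreT_zero_of_momentumSizes`** (named thresholds) / **`_stub5`** — from `mₖ ≥ ‖Dᵏ evalM (symInterp L (σ₀ − K∘p))‖` (k ≤ 2),
  aliasing sizes `aₖ`, the (E3c) response `ρ₀` (value level), the (E3d) field strength on the shell (direct), and three fits;
* **`twoLegCoreT_succ_of_momentumSizes`** / **`_stub5`** — from `Mₖ ≥ ‖Dᵏ evalM (symInterp L (σ_{n+1} − σ_n))‖` (k ≤ 2), the (E3c) increment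
  response `ρ_Δ` (value level), `m₁' ≥ ‖D¹ evalM (symInterp L (σ_{n+1} − K∘p))‖` + `a₁` for (E3e), the field strength on the shell, fits.

Proofs only; nothing about the model is asserted.  References: BGM 2006 §2.4 (2.36) [cite: BenfattoGiulianiMastropietro2006].
-/

noncomputable section

namespace Summit.HubbardSuperconductivity.HubbardSuperconductivity.Theorems.KLRegimeSplit

set_option linter.dupNamespace false -- summit = problem name (single-conjunct summit), D-0017

open Real Finset
open Literature.MathematicalPhysics.QuantumLattice Literature.MathematicalPhysics.QuantumLattice.BandSectorCounting
open Literature.Probability.LatticeModels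
open Summit.HubbardSuperconductivity.HubbardSuperconductivity.Theorems.DispersionFlow
open Summit.HubbardSuperconductivity.HubbardSuperconductivity.Theorems.PerturbedFermiCurve
open Summit.HubbardSuperconductivity.HubbardSuperconductivity.Theorems.KLProgrammeLegKernels
open Summit.HubbardSuperconductivity.HubbardSuperconductivity.Theorems.TwoLegFourier
open Summit.HubbardSuperconductivity.HubbardSuperconductivity.Theorems.EngineV8

variable {L M : ℕ} [NeZero L] [NeZero M]

/-! ## §1 Scale 0 -/

/-- **`TwoLegCoreT hist … K 0` from MOMENTUM-SIDE sizes, NAMED thresholds.** -/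
theorem twoLegCoreT_zero_of_momentumSizes {R : RenConsts} (hR : ∀ j, 0 ≤ R.Gfr j) {c : ℝ} (hc : 0 < c)
    (hcle : c ≤ klCurveC3 R) {U : ℝ} (hU : 0 < U) (hUle : U ≤ klCurveU0 R) {β : ℝ} (hβmin : klBetaMin ≤ β)
    (hβc : β ≤ Real.exp (c / U ^ 2)) {μ : ℝ} (hμ : μ ∈ klWindowC) {K : TrigPolyC4v} (hK : FrameOK R U (nScales β) μ K)
    (hist : TrigPolyC4v → ℕ → Prop) (G : GeoConsts) (P : SplitConsts) (Q : EngConsts)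
    {m a : ℕ → ℝ}
    (hm : ∀ k ≤ 2, ∀ p : Momentum, ‖iteratedFDeriv ℝ k
      (evalM (symInterp L (fun q => klLocSelfEnergyRe L M β U μ K 0 q - K.eval (latticeMomentum L q)))) p‖ ≤ m k)
    (ha : ∀ k ≤ 2, ∀ p : Momentum, ‖iteratedFDeriv ℝ k
      (fun p : Momentum => evalM (symInterp L (fun q => K.eval (latticeMomentum L q))) p - evalM K p) p‖ ≤ a k)
    (hfitS : ∀ j ≤ 2, (if j = 0 then m 0 + a 0 else 0) +
      (j.factorial : ℝ) ^ 2 * (2 * j.factorial * 1110 * 200 ^ j) *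
        (if j = 0 then 2 * (m 0 + a 0) else
          (2 * π + 1) * ((m 1 + a 1) * klCurveD1) + (if j = 2 then (m 2 + a 2) * klCurveD1 ^ 2 + (m 1 + a 1) * klCurveD2 else 0)) *
        (4 + max 1 (((j - 1).factorial : ℝ) / (8 / 5))) ^ j ≤ twoLegBar G Q U j 0)
    {ρ₀ : ℝ}
    (hr₀ : ∀ K' : TrigPolyC4v, FrameOK R U (klTempScaleIdx β klE0) μ K' → ∀ θ : ℝ,
      |((symInterp L (klLocSelfEnergyRe L M β U μ K 0)).eval (klFermiPoint μ K' θ) - K.eval (klFermiPoint μ K' θ)) -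
        ((symInterp L (klLocSelfEnergyRe L M β U μ K' 0)).eval (klFermiPoint μ K' θ) - K'.eval (klFermiPoint μ K' θ))| ≤
        ρ₀ * frameDist K K')
    (hfitL : ρ₀ + (m 1 + a 1) / klCurveD ≤ lipBar G Q U 0)
    (hz : ∀ k ∈ klShell L μ K 0, |klFieldStrength L M β U μ K 0 k - 1| ≤ R.cz * |U|)
    (hfit1 : m 1 + a 1 + 4 / 3 * R.Gfr 1 * U ^ 2 ≤ R.cz * |U| * (cDtmin (-1.2) (-0.05) / 2)) :
    TwoLegCoreT L M hist G P Q R β U μ K 0 := by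
  have ha' : (-4 : ℝ) < -1.1 := by norm_num
  have hab : (-1.1 : ℝ) ≤ -0.1 := by norm_num
  have hb : (-0.1 : ℝ) < 0 := by norm_num
  obtain ⟨hAf, hA20, hADt, -, ⟨hlo, hhi⟩, -, -⟩ := frame_sizes_of_frameOK_explicit hR hc hcle hU hUle hβmin hβc hμ hK
  have hgrad := fun q => norm_fderiv_scaleZero_reading_le_sep (L := L) (M := M) (hm 1 (by norm_num)) (ha 1 (by norm_num)) q
  have hb₀ : 0 ≤ m 1 + a 1 := (norm_nonneg _).trans (hgrad 0).1
  have h0 : ContDiff ℝ 4 (klLocalPart L M β U μ K 0) := contDiff_klLocalPart (bandBounds ha' hab hb) hAf hADt hlo hhi L M β U 0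
  have hKc : ContDiff ℝ 4 (fun θ => K.eval (klFermiPoint μ K θ)) := contDiff_eval_klFermiPoint (bandBounds ha' hab hb) hAf hADt hlo hhi K
  refine ⟨⟨?_, fun j hj q => ?_⟩, ?_, ?_⟩
  · have hP := klTwoLegPieceFn_eval_zero (L := L) (M := M) β U μ K h0.continuous hKc.continuous
    have hδ : ContDiff ℝ (4 : ℕ∞) (fun θ => klLocalPart L M β U μ K 0 θ - K.eval (klFermiPoint μ K θ)) := by
      exact_mod_cast h0.sub hKc
    have hper : Function.Periodic (fun θ => klLocalPart L M β U μ K 0 θ - K.eval (klFermiPoint μ K θ)) (2 * π) := fun θ => by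
      simp only [klLocalPart_periodic β U μ K 0 θ, frameOnCurve_periodic μ K θ]
    exact_mod_cast contDiff_onM_piece hP hδ hper hμ
  · exact (twoLegPieceFn_eval_zero_tier1_size_le_sep (L := L) (M := M) hR hc hcle hU hUle hβmin hβc hμ hK hm ha hj
      (fun l hl x => norm_iteratedFDeriv_salmhoferCutoff_le_of_le_two (hl.trans hj) x) q).trans (hfitS j hj)
  · exact frameLipschitzFnT_zero_of_responses_explicit (L := L) (M := M) hR hc hcle hU hUle hβmin hβc hμ hK hist G Q hb₀
      (fun q => (hgrad q).1) hr₀ hfitL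
  · have haw : (-4 : ℝ) < -1.2 := by norm_num
    have habw : (-1.2 : ℝ) ≤ -0.05 := by norm_num
    have hbw : (-0.05 : ℝ) < 0 := by norm_num
    set B := bandBounds haw habw hbw with hBdef
    have hBD : B.Dtmin = cDtmin (-1.2) (-0.05) := rfl
    have hAfw : ∀ p : Momentum, ∀ j ≤ 2, ‖iteratedFDeriv ℝ j (frameShift K) p‖ ≤
        2 * R.Gfr 0 * |U| + 2 * R.Gfr 1 * U ^ 2 + R.Gfr 2 * (c / Real.log 4) := fun p j hj =>
      norm_iteratedFDeriv_frameShift_le_of_frameOK_regime hR hc.le hβmin hβc hK p hj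
    obtain ⟨hA20w, hADtw, hhalf⟩ := two_frameSize_lt_cDtmin_wide hR hc.le hcle hU hUle
    have hADt' : 2 * (2 * R.Gfr 0 * |U| + 2 * R.Gfr 1 * U ^ 2 + R.Gfr 2 * (c / Real.log 4)) < B.Dtmin := by rw [hBD]; exact hADtw
    obtain ⟨hloΛ, hhiΛ⟩ := klWindowC_shell_margin hμ hA20w (klScale_klE0_le_klE0 0)
    have h13 : 0 ≤ 4 / 3 * R.Gfr 1 * U ^ 2 := by have := hR 1; positivity
    have hczU : 0 ≤ R.cz * |U| := by
      by_contra hneg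
      have hneg' : R.cz * |U| < 0 := lt_of_not_ge hneg
      have : R.cz * |U| * (cDtmin (-1.2) (-0.05) / 2) < 0 := mul_neg_of_neg_of_pos hneg' (by linarith [cDtmin_wide_ge])
      linarith
    set bS : ℝ := m 1 + a 1 + 4 / 3 * R.Gfr 1 * U ^ 2 with hbS
    have hbS0 : 0 ≤ bS := by positivity
    have hgradS : ∀ q : Momentum, ‖fderiv ℝ (evalM (symInterp L (klLocSelfEnergyRe L M β U μ K 0))) q‖ ≤ bS := fun q =>
      (hgrad q).2.trans (by rw [hbS]; linarith [norm_iteratedFDeriv_one_frameShift_le_of_frameOK hR hK q])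
    have hb' : bS ≤ R.cz * |U| * (B.Dtmin - 2 * (2 * R.Gfr 0 * |U| + 2 * R.Gfr 1 * U ^ 2 + R.Gfr 2 * (c / Real.log 4))) :=
      hfit1.trans (mul_le_mul_of_nonneg_left (by rw [hBD]; exact hhalf) hczU)
    exact twoLegSlopes_of_fieldStrength_of_gradient B hAfw hADt' hloΛ hhiΛ (selfEnergySymmetric_all L M β U μ K 0) hz hbS0 hgradS hb'

/-! ## §2 Scale `n + 1` -/

/-- **`TwoLegCoreT hist … K (n+1)` from MOMENTUM-SIDE sizes, NAMED thresholds.** -/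
theorem twoLegCoreT_succ_of_momentumSizes {R : RenConsts} (hR : ∀ j, 0 ≤ R.Gfr j) {c : ℝ} (hc : 0 < c)
    (hcle : c ≤ klCurveC3 R) {U : ℝ} (hU : 0 < U) (hUle : U ≤ klCurveU0 R) {β : ℝ} (hβmin : klBetaMin ≤ β)
    (hβc : β ≤ Real.exp (c / U ^ 2)) {μ : ℝ} (hμ : μ ∈ klWindowC) {K : TrigPolyC4v} (hK : FrameOK R U (nScales β) μ K)
    (hist : TrigPolyC4v → ℕ → Prop) (G : GeoConsts) (P : SplitConsts) (Q : EngConsts) (n : ℕ)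
    {Mv : ℕ → ℝ}
    (hM : ∀ k ≤ 2, ∀ p : Momentum, ‖iteratedFDeriv ℝ k
      (evalM (symInterp L fun q => klLocSelfEnergyRe L M β U μ K (n + 1) q - klLocSelfEnergyRe L M β U μ K n q)) p‖ ≤ Mv k)
    (hfitS : ∀ j ≤ 2, (if j = 0 then Mv 0 else 0) +
      (j.factorial : ℝ) ^ 2 * (2 * j.factorial * 1110 * 200 ^ j) *
        (if j = 0 then 2 * Mv 0 else (2 * π + 1) * (Mv 1 * klCurveD1) + (if j = 2 then Mv 2 * klCurveD1 ^ 2 + Mv 1 * klCurveD2 else 0)) *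
        (4 + max 1 (((j - 1).factorial : ℝ) / (8 / 5))) ^ j ≤ twoLegBar G Q U j (n + 1))
    {ρΔ : ℝ}
    (hr : ∀ K' : TrigPolyC4v, FrameOK R U (klTempScaleIdx β klE0) μ K' → (∀ j < n + 1, hist K' j) → ∀ θ : ℝ,
      |((symInterp L (klLocSelfEnergyRe L M β U μ K (n + 1))).eval (klFermiPoint μ K' θ) -
          (symInterp L (klLocSelfEnergyRe L M β U μ K n)).eval (klFermiPoint μ K' θ)) -
        ((symInterp L (klLocSelfEnergyRe L M β U μ K' (n + 1))).eval (klFermiPoint μ K' θ) -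
          (symInterp L (klLocSelfEnergyRe L M β U μ K' n)).eval (klFermiPoint μ K' θ))| ≤ ρΔ * frameDist K K')
    (hfitL : ρΔ + Mv 1 / klCurveD ≤ lipBar G Q U (n + 1))
    {m₁' a₁ : ℝ}
    (hm₁' : ∀ p : Momentum, ‖iteratedFDeriv ℝ 1
      (evalM (symInterp L (fun q => klLocSelfEnergyRe L M β U μ K (n + 1) q - K.eval (latticeMomentum L q)))) p‖ ≤ m₁')
    (ha₁ : ∀ p : Momentum, ‖iteratedFDeriv ℝ 1
      (fun p : Momentum => evalM (symInterp L (fun q => K.eval (latticeMomentum L q))) p - evalM K p) p‖ ≤ a₁)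
    (hz : ∀ k ∈ klShell L μ K (n + 1), |klFieldStrength L M β U μ K (n + 1) k - 1| ≤ R.cz * |U|)
    (hfit1 : m₁' + a₁ + 4 / 3 * R.Gfr 1 * U ^ 2 ≤ R.cz * |U| * (cDtmin (-1.2) (-0.05) / 2)) :
    TwoLegCoreT L M hist G P Q R β U μ K (n + 1) := by
  have ha' : (-4 : ℝ) < -1.1 := by norm_num
  have hab : (-1.1 : ℝ) ≤ -0.1 := by norm_num
  have hb : (-0.1 : ℝ) < 0 := by norm_num
  obtain ⟨hAf, hA20, hADt, -, ⟨hlo, hhi⟩, -, -⟩ := frame_sizes_of_frameOK_explicit hR hc hcle hU hUle hβmin hβc hμ hK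
  have hνC : ∀ k : ℕ, ContDiff ℝ 4 (klLocalPart L M β U μ K k) := fun k =>
    contDiff_klLocalPart (bandBounds ha' hab hb) hAf hADt hlo hhi L M β U k
  have hgΔ : ∀ q : Momentum, ‖fderiv ℝ (fun q : Momentum =>
      evalM (symInterp L (klLocSelfEnergyRe L M β U μ K (n + 1))) q - evalM (symInterp L (klLocSelfEnergyRe L M β U μ K n)) q) q‖ ≤
      Mv 1 := fun q => by
    have hfun : (fun q : Momentum =>
        evalM (symInterp L (klLocSelfEnergyRe L M β U μ K (n + 1))) q - evalM (symInterp L (klLocSelfEnergyRe L M β U μ K n)) q) =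
        evalM (symInterp L fun k => klLocSelfEnergyRe L M β U μ K (n + 1) k - klLocSelfEnergyRe L M β U μ K n k) := by
      funext q; simp only [evalM_apply, eval_symInterp_sub]
    rw [hfun, ← norm_iteratedFDeriv_one]
    exact hM 1 (by norm_num) q
  have hMv10 : 0 ≤ Mv 1 := (norm_nonneg _).trans (hgΔ 0)
  refine ⟨⟨?_, fun j hj q => ?_⟩, ?_, ?_⟩
  · have hP := klTwoLegPieceFn_eval_succ (L := L) (M := M) β U μ K n (hνC (n + 1)).continuous (hνC n).continuous
    have hδ : ContDiff ℝ (4 : ℕ∞) (fun θ => klLocalPart L M β U μ K (n + 1) θ - klLocalPart L M β U μ K n θ) := by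
      exact_mod_cast (hνC (n + 1)).sub (hνC n)
    have hper : Function.Periodic (fun θ => klLocalPart L M β U μ K (n + 1) θ - klLocalPart L M β U μ K n θ) (2 * π) := fun θ => by
      simp only [klLocalPart_periodic β U μ K (n + 1) θ, klLocalPart_periodic β U μ K n θ]
    exact_mod_cast contDiff_onM_piece hP hδ hper hμ
  · exact (twoLegPieceV13_tier1_size_le_sep (L := L) (M := M) hR hc hcle hU hUle hβmin hβc hμ hK n hM hj
      (fun l hl x => norm_iteratedFDeriv_salmhoferCutoff_le_of_le_two (hl.trans hj) x) q).trans (hfitS j hj)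
  · exact frameLipschitzFnT_succ_of_increment_responses_explicit (L := L) (M := M) hR hc hcle hU hUle hβmin hβc hμ hK hist G Q n
      hMv10 hgΔ hr hfitL
  · have haw : (-4 : ℝ) < -1.2 := by norm_num
    have habw : (-1.2 : ℝ) ≤ -0.05 := by norm_num
    have hbw : (-0.05 : ℝ) < 0 := by norm_num
    set B := bandBounds haw habw hbw with hBdef
    have hBD : B.Dtmin = cDtmin (-1.2) (-0.05) := rfl
    have hAfw : ∀ p : Momentum, ∀ j ≤ 2, ‖iteratedFDeriv ℝ j (frameShift K) p‖ ≤
        2 * R.Gfr 0 * |U| + 2 * R.Gfr 1 * U ^ 2 + R.Gfr 2 * (c / Real.log 4) := fun p j hj =>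
      norm_iteratedFDeriv_frameShift_le_of_frameOK_regime hR hc.le hβmin hβc hK p hj
    obtain ⟨hA20w, hADtw, hhalf⟩ := two_frameSize_lt_cDtmin_wide hR hc.le hcle hU hUle
    have hADt' : 2 * (2 * R.Gfr 0 * |U| + 2 * R.Gfr 1 * U ^ 2 + R.Gfr 2 * (c / Real.log 4)) < B.Dtmin := by rw [hBD]; exact hADtw
    obtain ⟨hloΛ, hhiΛ⟩ := klWindowC_shell_margin hμ hA20w (klScale_klE0_le_klE0 (n + 1))
    have h13 : 0 ≤ 4 / 3 * R.Gfr 1 * U ^ 2 := by have := hR 1; positivity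
    have hm0 : 0 ≤ m₁' := (norm_nonneg _).trans (hm₁' 0)
    have ha0 : 0 ≤ a₁ := (norm_nonneg _).trans (ha₁ 0)
    have hczU : 0 ≤ R.cz * |U| := by
      by_contra hneg
      have hneg' : R.cz * |U| < 0 := lt_of_not_ge hneg
      have : R.cz * |U| * (cDtmin (-1.2) (-0.05) / 2) < 0 := mul_neg_of_neg_of_pos hneg' (by linarith [cDtmin_wide_ge])
      linarith
    set bS : ℝ := m₁' + a₁ + 4 / 3 * R.Gfr 1 * U ^ 2 with hbS
    have hbS0 : 0 ≤ bS := by positivity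
    have hgradS : ∀ q : Momentum, ‖fderiv ℝ (evalM (symInterp L (klLocSelfEnergyRe L M β U μ K (n + 1)))) q‖ ≤ bS := fun q =>
      (norm_fderiv_evalM_twoLegPoly_le_sep (L := L) (M := M) hm₁' ha₁ q).trans
        (by rw [hbS]; linarith [norm_iteratedFDeriv_one_frameShift_le_of_frameOK hR hK q])
    have hb' : bS ≤ R.cz * |U| * (B.Dtmin - 2 * (2 * R.Gfr 0 * |U| + 2 * R.Gfr 1 * U ^ 2 + R.Gfr 2 * (c / Real.log 4))) :=
      hfit1.trans (mul_le_mul_of_nonneg_left (by rw [hBD]; exact hhalf) hczU)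
    exact twoLegSlopes_of_fieldStrength_of_gradient B hAfw hADt' hloΛ hhiΛ (selfEnergySymmetric_all L M β U μ K (n + 1)) hz hbS0
      hgradS hb'

/-! ## §3 Stub-keyed corollaries (skeleton 26ce2d93b9f90451: `G := klEngGeo3`, `Q := klEngQ5 P R`) -/

/-- **Stub-keyed, momentum-side scale-0 `TwoLegCoreT`** (`stub_twoLeg_scale0`'s literal binders). -/
theorem twoLegCoreT_zero_of_momentumSizes_stub5 (P : SplitConsts) {R : RenConsts} (hRW : R.WF2) {c : ℝ} (hc : 0 < c)
    (hcle : c ≤ klEngC₃3 P R) {U : ℝ} (hU : 0 < U) (hUle : U ≤ klEngU₀3 P R c) {β : ℝ} (hβmin : klBetaMin ≤ β)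
    (hβc : β ≤ Real.exp (c / U ^ 2)) {μ : ℝ} (hμ : μ ∈ klWindowC) {K : TrigPolyC4v} (hK : FrameOK R U (nScales β) μ K)
    (hist : TrigPolyC4v → ℕ → Prop) {m a : ℕ → ℝ}
    (hm : ∀ k ≤ 2, ∀ p : Momentum, ‖iteratedFDeriv ℝ k
      (evalM (symInterp L (fun q => klLocSelfEnergyRe L M β U μ K 0 q - K.eval (latticeMomentum L q)))) p‖ ≤ m k)
    (ha : ∀ k ≤ 2, ∀ p : Momentum, ‖iteratedFDeriv ℝ k
      (fun p : Momentum => evalM (symInterp L (fun q => K.eval (latticeMomentum L q))) p - evalM K p) p‖ ≤ a k)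
    (hfitS : ∀ j ≤ 2, (if j = 0 then m 0 + a 0 else 0) +
      (j.factorial : ℝ) ^ 2 * (2 * j.factorial * 1110 * 200 ^ j) *
        (if j = 0 then 2 * (m 0 + a 0) else
          (2 * π + 1) * ((m 1 + a 1) * klCurveD1) + (if j = 2 then (m 2 + a 2) * klCurveD1 ^ 2 + (m 1 + a 1) * klCurveD2 else 0)) *
        (4 + max 1 (((j - 1).factorial : ℝ) / (8 / 5))) ^ j ≤ twoLegBar klEngGeo3 (klEngQ5 P R) U j 0)
    {ρ₀ : ℝ}
    (hr₀ : ∀ K' : TrigPolyC4v, FrameOK R U (klTempScaleIdx β klE0) μ K' → ∀ θ : ℝ,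
      |((symInterp L (klLocSelfEnergyRe L M β U μ K 0)).eval (klFermiPoint μ K' θ) - K.eval (klFermiPoint μ K' θ)) -
        ((symInterp L (klLocSelfEnergyRe L M β U μ K' 0)).eval (klFermiPoint μ K' θ) - K'.eval (klFermiPoint μ K' θ))| ≤
        ρ₀ * frameDist K K')
    (hfitL : ρ₀ + (m 1 + a 1) / klCurveD ≤ lipBar klEngGeo3 (klEngQ5 P R) U 0)
    (hz : ∀ k ∈ klShell L μ K 0, |klFieldStrength L M β U μ K 0 k - 1| ≤ R.cz * |U|)
    (hfit1 : m 1 + a 1 + 4 / 3 * R.Gfr 1 * U ^ 2 ≤ R.cz * |U| * (cDtmin (-1.2) (-0.05) / 2)) :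
    TwoLegCoreT L M hist klEngGeo3 P (klEngQ5 P R) R β U μ K 0 :=
  have hR : ∀ j, 0 ≤ R.Gfr j := hRW.1.2.2
  twoLegCoreT_zero_of_momentumSizes (L := L) (M := M) hR hc (hcle.trans (klEngC₃3_le_klCurveC3 P hR)) hU
    (hUle.trans (klEngU₀3_le_klCurveU0 P hR c)) hβmin hβc hμ hK hist klEngGeo3 P (klEngQ5 P R) hm ha hfitS hr₀ hfitL hz hfit1

/-- **Stub-keyed, momentum-side `TwoLegCoreT` at scale `n + 1`** (`stub_twoLeg_step`'s literal binders). -/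
theorem twoLegCoreT_succ_of_momentumSizes_stub5 (P : SplitConsts) {R : RenConsts} (hRW : R.WF2) {c : ℝ} (hc : 0 < c)
    (hcle : c ≤ klEngC₃3 P R) {U : ℝ} (hU : 0 < U) (hUle : U ≤ klEngU₀3 P R c) {β : ℝ} (hβmin : klBetaMin ≤ β)
    (hβc : β ≤ Real.exp (c / U ^ 2)) {μ : ℝ} (hμ : μ ∈ klWindowC) {K : TrigPolyC4v} (hK : FrameOK R U (nScales β) μ K)
    (hist : TrigPolyC4v → ℕ → Prop) (n : ℕ) {Mv : ℕ → ℝ}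
    (hM : ∀ k ≤ 2, ∀ p : Momentum, ‖iteratedFDeriv ℝ k
      (evalM (symInterp L fun q => klLocSelfEnergyRe L M β U μ K (n + 1) q - klLocSelfEnergyRe L M β U μ K n q)) p‖ ≤ Mv k)
    (hfitS : ∀ j ≤ 2, (if j = 0 then Mv 0 else 0) +
      (j.factorial : ℝ) ^ 2 * (2 * j.factorial * 1110 * 200 ^ j) *
        (if j = 0 then 2 * Mv 0 else (2 * π + 1) * (Mv 1 * klCurveD1) + (if j = 2 then Mv 2 * klCurveD1 ^ 2 + Mv 1 * klCurveD2 else 0)) *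
        (4 + max 1 (((j - 1).factorial : ℝ) / (8 / 5))) ^ j ≤ twoLegBar klEngGeo3 (klEngQ5 P R) U j (n + 1))
    {ρΔ : ℝ}
    (hr : ∀ K' : TrigPolyC4v, FrameOK R U (klTempScaleIdx β klE0) μ K' → (∀ j < n + 1, hist K' j) → ∀ θ : ℝ,
      |((symInterp L (klLocSelfEnergyRe L M β U μ K (n + 1))).eval (klFermiPoint μ K' θ) -
          (symInterp L (klLocSelfEnergyRe L M β U μ K n)).eval (klFermiPoint μ K' θ)) -
        ((symInterp L (klLocSelfEnergyRe L M β U μ K' (n + 1))).eval (klFermiPoint μ K' θ) -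
          (symInterp L (klLocSelfEnergyRe L M β U μ K' n)).eval (klFermiPoint μ K' θ))| ≤ ρΔ * frameDist K K')
    (hfitL : ρΔ + Mv 1 / klCurveD ≤ lipBar klEngGeo3 (klEngQ5 P R) U (n + 1))
    {m₁' a₁ : ℝ}
    (hm₁' : ∀ p : Momentum, ‖iteratedFDeriv ℝ 1
      (evalM (symInterp L (fun q => klLocSelfEnergyRe L M β U μ K (n + 1) q - K.eval (latticeMomentum L q)))) p‖ ≤ m₁')
    (ha₁ : ∀ p : Momentum, ‖iteratedFDeriv ℝ 1
      (fun p : Momentum => evalM (symInterp L (fun q => K.eval (latticeMomentum L q))) p - evalM K p) p‖ ≤ a₁)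
    (hz : ∀ k ∈ klShell L μ K (n + 1), |klFieldStrength L M β U μ K (n + 1) k - 1| ≤ R.cz * |U|)
    (hfit1 : m₁' + a₁ + 4 / 3 * R.Gfr 1 * U ^ 2 ≤ R.cz * |U| * (cDtmin (-1.2) (-0.05) / 2)) :
    TwoLegCoreT L M hist klEngGeo3 P (klEngQ5 P R) R β U μ K (n + 1) :=
  have hR : ∀ j, 0 ≤ R.Gfr j := hRW.1.2.2
  twoLegCoreT_succ_of_momentumSizes (L := L) (M := M) hR hc (hcle.trans (klEngC₃3_le_klCurveC3 P hR)) hU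
    (hUle.trans (klEngU₀3_le_klCurveU0 P hR c)) hβmin hβc hμ hK hist klEngGeo3 P (klEngQ5 P R) n hM hfitS hr hfitL hm₁' ha₁ hz hfit1

end Summit.HubbardSuperconductivity.HubbardSuperconductivity.Theorems.KLRegimeSplit

end
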